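/-
Copyright (c) 2026. All rights reserved.
Released under Apache 2.0 license as described in the file LICENSE.
Authors: abc-iut cell — seat abc-iut-w6-d024 (gen 4; block C / W6, L4-lead RULING #7o row «COR27e-TYPE»):
STATEMENT ONLY — the reconstruction clause of [AbsTopIII] Cor 2.7 (e) at the germ MODEL of Prop 2.6
(abc-iut-w4-d104, p411929/p412140/p412533) in the one-parameter-subgroup language of Cor 2.7 (d)
(abc-iut-L4-t7, p427469; abc-iut-w4-d104's disc files).  No instance, no notation, nothing asserted.
-/
import Literature.AnabelianGeometry.AbsoluteAnabelian.HolomorphicCoresLocalLinearProofs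
import Literature.AnabelianGeometry.AbsoluteAnabelian.AutHolomorphicSpaces
import Mathlib.Analysis.Calculus.Deriv.Basic
import HarnessLib

/-!
# [AbsTopIII] Cor 2.7 (e): the group `𝒜_p` cut out by the Aut-holomorphic space alone (germ model, statement)

S. Mochizuki, *Topics in absolute anabelian geometry III* (bib key `MochizukiAbsTopIII2015`; locators =
kurims manuscript pages, cell render `AbsTopIII-kurims-url-5493eb38cbb7`), Cor 2.7 pp.58–60: "there exists
a functorial algorithm for constructing the 'local linear holomorphic structure' [cf. Proposition 2.6] on
`X^top` that involves only the Aut-holomorphic space `𝕏` as input data, as follows: […] (d) […] one may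
construct the orthogonal frames of `E^top` as the frames consisting of pairs of line segments `L₁, L₂`
emanating from a point `p ∈ E^top` that are tangent, respectively, to orbits `S₁ · p`, `S₂ · p` of
one-parameter subgroups `S₁, S₂ ⊆ 𝒜_𝕍(V^top)` such that `S₂` is obtained from `S₁` by conjugating `S₁`
by an element of order four [i.e., '`±i`'] of a compact one-parameter subgroup [i.e., a 'one-dimensional
torus'] of `𝒜_𝕍(V^top)` that fixes `p`" (p.59 l.39–45); "(e) For `p ∈ E^top`, write `𝒜_p` for the group
of automorphisms of the projective system of connected open neighborhoods of `p` in `E^top` that are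
compatible with the 'local additive structures' of (c) and preserve the orthogonal frames and
orientations [at `p`] of (c), (d) [cf. Proposition 2.6, (a)].  Then just as in Proposition 2.6, (a), we
obtain topological field structures on `𝒜_p ∪ {0}`, together with compatible isomorphisms `𝒜_p ⥲ 𝒜_{p'}`,
for `p' ∈ E^top`.  This system of '`𝒜_p`'s' may be thought of as a system of 'local linear holomorphic
structures' on `E^top` or `X^top`" (p.60 l.2–14).

## What the tree already has, and what this file types

* The OUTPUT of (e) is typed as the interface `LocalLinearHolStructure` (`HolomorphicCores.lean`,
  abc-iut-L4-t14) and, for a charted space, tautologically as `linHolStructureOfCharted`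
  (`ArchimedeanReconstruction.lean`, abc-iut-L4-t2/t12), whose docstring records that the content of
  Cor 2.7 — recovery "from the Aut-holomorphic orbispace alone" — is "not separately typed: it needs germ
  actions, cf. Prop 2.6".
* The germ MODEL of Prop 2.6 (abc-iut-w4-d104): `LocGerm p` (germs at `p` of self-maps of `ℂ` tending to
  `p`), the group `germAut p ≤ (LocGerm p)ˣ` cut out by `IsAddCompat` (local additive structure of
  Prop 2.5 (e)), `PreservesOrthFrames` (EUCLIDEAN orthogonal frames, Rmk 2.5.1) and `PreservesOrientation`,
  the rigidity `mem_germAut_iff` (`𝒜_p` = the germs `z ↦ p + c (z − p)`, `c ∈ ℂ^×`), the isomorphism of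
  topological groups `germAutIsoUnits p : ℂ^× ≃ₜ* 𝒜_p`, the transitions `germAutTrans`, and
  `localLinearHolStructureOfGerms`; its FUNCTORIALITY along holomorphic (finite étale / chart) maps is
  "same multiplier" (`HolomorphicCoresGermEtaleFunctoriality`, `…GermChartIndependence`, GAP G-w5d226-1).
* Cor 2.7 (d) in the typed language (abc-iut-L4-t7 p427469 `oneParameterSubgroups_holAut`; abc-iut-w4-d104
  `inner_eq_zero_of_tangent_conj_oneParameterSubgroup`, `inner_eq_zero_iff_tangent_conj_orbits`):
  one-parameter subgroups are continuous homomorphisms `f : ℝ → Aut^hol(V) = holAut ⊤` for the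
  compact-open topology (`homeoCompactOpen`), and the frames tangent to `S₁ · p`, `(k S₁ k⁻¹) · p` are the
  Euclidean orthogonal frames at `p` (model level: `V` a planar Aut-holomorphic disc).

What print ADDS in (e) over Prop 2.6 (a) — and what no tree file states (abc-iut-L4-t8's per-item table,
cell STATUS 2026-08-26T09:14:44Z: "(e) … the reconstruction clause UNTYPED") — is that `𝒜_p` is cut out
using the orthogonal frames OF (d), i.e. frames read off the group `𝒜_𝕍(V^top) = Aut^hol(V)` ALONE,
instead of the Euclidean frames of Rmk 2.5.1.  This file types exactly that, as ONE named `Prop` over the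
germ model and the one-parameter-subgroup language, with two auxiliary HONEST definitions:

* `autHolOrthFramesAt V p` — the pairs of tangent vectors at `p` of the printed frames of (d): positive
  real multiples of the velocities at `p` of the orbits `t ↦ f(t) · p` and `t ↦ (k f(t) k⁻¹) · p`;
* `germAutFromAutHol V p` — the set of germ automorphisms at `p` "compatible with the local additive
  structures of (c)" (`IsAddCompat`), preserving "the orientations [at `p`] of (c)"
  (`PreservesOrientation`) and preserving the orthogonal frames OF (d): the (unique, `linGerm_injective`)
  linear part maps `autHolOrthFramesAt V p` into itself;
* `Cor27eGermAutFromAutHol` — THE NAMED FACT: for every planar Aut-holomorphic disc `V` and `p ∈ V`,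
  `germAutFromAutHol V p = germAut p`.  ("Then just as in Proposition 2.6, (a), we obtain …": with this
  equality the topological field `𝒜_p ∪ {0}` and the compatible `𝒜_p ⥲ 𝒜_{p'}` are the germ model's
  `germAutIsoUnits` / `germAutTrans` / `localLinearHolStructureOfGerms`.)

HONEST SCOPE.  MODEL LEVEL: `V = V^top` is a planar Aut-holomorphic disc — the chart picture, in the
uniformising coordinate of the once-punctured elliptic curve `E^top`, of "the Aut-holomorphic space
determined by a parallelogram `V^top ⊆ E^top` [cf. (c)]" (p.59 l.27–28), where the local additive
structure of (c) (the group law of the elliptic curve, `TorsionPointsDenseUniqueGroupLaw`) and the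
orientations of Prop 2.5 (d) ARE the planar ones used by `IsAddCompat` / `PreservesOrientation`.  NOT typed
here (campaign-L / (c).4 `puncturedEllipticCurveModel_holds` territory): the identification of the
(c)-group-law additive structure with the planar one at a genuine `𝔼`, and the transport of the system
of `𝒜_p`'s to the orbispace `X^top` along `E → H ← X` ((e), last sentence; (f)).  Named fact, NOT
asserted (D-0014); provable from abc-iut-w4-d104's (d)-disc files — proof-only companion to follow.
Refereed pre-IUT material; nothing here bears on the disputed [IUTchIII] Cor. 3.12; typed ≠ proved.
-/

noncomputable section

namespace Literature.AnabelianGeometry.AbsoluteAnabelian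

open _root_.TopologicalSpace _root_.Topology _root_.Set

/-- **The orthogonal frames of Cor 2.7 (d), as tangent-vector pairs at `p`** (germ level), read off the
group `𝒜_𝕍(V^top) = Aut^hol(V)` alone: "frames consisting of pairs of line segments `L₁, L₂` emanating from
a point `p` … that are tangent, respectively, to orbits `S₁ · p`, `S₂ · p` of one-parameter subgroups
`S₁, S₂ ⊆ 𝒜_𝕍(V^top)` such that `S₂` is obtained from `S₁` by conjugating `S₁` by an element of order four …
of a compact one-parameter subgroup … that fixes `p`" — the pairs `(r₁ · v₁, r₂ · v₂)`, `0 < r₁, r₂`, where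
`v₁` is the velocity at `p` of `t ↦ f(t) · p` and `v₂` that of `t ↦ (k f(t) k⁻¹) · p`, for a continuous
one-parameter subgroup `f : ℝ → Aut^hol(V)` (compact-open topology, as in `oneParameterSubgroups_holAut`)
and `k ∈ Aut^hol(V)` with `k · p = p`, `k⁴ = 1 ≠ k²` (such a `k` lies in the compact one-parameter
stabiliser of `p`, abc-iut-w4-d104 `stab_eqOn_chartRot`).
[cite: MochizukiAbsTopIII2015, Corollary 2.7 (d) p.59] -/
def autHolOrthFramesAt (V : Opens ℂ) (p : V) : Set (ℂ × ℂ) :=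
  letI := homeoCompactOpen (⊤ : Opens V)
  {e | ∃ (f : Multiplicative ℝ →* holAut (⊤ : Opens V)) (k : holAut (⊤ : Opens V)) (r₁ r₂ : ℝ),
    Continuous f ∧
    ((k : holAut (⊤ : Opens V)) : (⊤ : Opens V) ≃ₜ (⊤ : Opens V)) ⟨p, trivial⟩ = ⟨p, trivial⟩ ∧
    k * k * k * k = 1 ∧ k * k ≠ 1 ∧ 0 < r₁ ∧ 0 < r₂ ∧
    e.1 = (r₁ : ℂ) * deriv (fun t : ℝ =>
      (((((f (Multiplicative.ofAdd t) : holAut (⊤ : Opens V)) : (⊤ : Opens V) ≃ₜ (⊤ : Opens V))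
        ⟨p, trivial⟩ : (⊤ : Opens V)) : V) : ℂ)) 0 ∧
    e.2 = (r₂ : ℂ) * deriv (fun t : ℝ =>
      (((((k * f (Multiplicative.ofAdd t) * k⁻¹ : holAut (⊤ : Opens V)) : (⊤ : Opens V) ≃ₜ (⊤ : Opens V))
        ⟨p, trivial⟩ : (⊤ : Opens V)) : V) : ℂ)) 0}

/-- **Cor 2.7 (e), the group `𝒜_p` as cut out by the Aut-holomorphic space**: the automorphisms of the
projective system of open neighbourhoods of `p` (units of the germ monoid `LocGerm p`, abc-iut-w4-d104)
"that are compatible with the 'local additive structures' of (c)" (`LocGerm.IsAddCompat` — hence affine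
germs `z ↦ p + L (z − p)` with a unique linear part `L`, `LocGerm.isAddCompat_iff`, `linGerm_injective`)
"and preserve the orthogonal frames and orientations [at `p`] of (c), (d)": the linear part maps the
frames of (d), `autHolOrthFramesAt V p`, to frames of (d), and the germ preserves the two orientations
at `p` (`LocGerm.PreservesOrientation`).  Compare `germAut p` (Prop 2.6 (a)), which uses the EUCLIDEAN
orthogonal frames of Rmk 2.5.1 (`LocGerm.PreservesOrthFrames`) instead.
[cite: MochizukiAbsTopIII2015, Corollary 2.7 (e) p.60] -/
def germAutFromAutHol (V : Opens ℂ) (p : V) : Set (LocGerm (p : ℂ))ˣ :=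
  {u | (u : LocGerm (p : ℂ)).IsAddCompat ∧ (u : LocGerm (p : ℂ)).PreservesOrientation ∧
    ∃ L : ℂ →L[ℝ] ℂ, (u : LocGerm (p : ℂ)) = LocGerm.linGerm (p : ℂ) L ∧
      MapsTo (Prod.map L L) (autHolOrthFramesAt V p) (autHolOrthFramesAt V p)}

/-- **[AbsTopIII] Cor 2.7 (e), the reconstruction clause at the germ model** ("involves only the
Aut-holomorphic space `𝕏` as input data … (e) … Then just as in Proposition 2.6, (a), we obtain
topological field structures on `𝒜_p ∪ {0}`, together with compatible isomorphisms `𝒜_p ⥲ 𝒜_{p'}`"):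
for every planar Aut-holomorphic disc `V` ("the Aut-holomorphic space determined by a parallelogram
`V^top ⊆ E^top`", (d)) and every `p ∈ V`, the group cut out using the orthogonal frames OF (d) — read
off `Aut^hol(V)` alone — IS the group `𝒜_p` of Prop 2.6 (a) of the germ model; whence, by
`germAutIsoUnits` / `germAutTrans` / `localLinearHolStructureOfGerms`, the topological field `𝒜_p ∪ {0}`
and the compatible isomorphisms.  MODEL LEVEL (planar chart of `E^top` in the uniformising coordinate,
where the local additive structure of (c) is the planar one); named `Prop` fact, NOT asserted.
[cite: MochizukiAbsTopIII2015, Corollary 2.7 (e) p.60] -/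
def Cor27eGermAutFromAutHol : Prop :=
  ∀ (V : Opens ℂ), IsAutHolDisc V → ∀ p : V,
    germAutFromAutHol V p = (germAut (p : ℂ) : Set (LocGerm (p : ℂ))ˣ)

end Literature.AnabelianGeometry.AbsoluteAnabelian

end
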